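import Summits.QuantumFields.YangMills.Theorems.VirialFluxGapRingPolyInsertion
import Summits.QuantumFields.YangMills.Theorems.VirialFluxGapRingFrameHessian
import HarnessLib

/-!
# Route `VirialFluxGap` (YangMills): the FIRST VARIATION of the zero-flux deficit at a history with ALL SLICES EQUAL — the temporal bonds drop
# out (toward the explicit cubic vertex `g₂` of the central chart)

Brick (C1, LEAD design note №4 (b): `g₂(z) = ∇F₀∘π_C`, the seam/plaquette vertex) for ⟨stmt-QuantumFields-24141⟩.  At a history whose `2L` time
slices are all equal to one configuration `U` (e.g. every comb-constant history `(combFlat h, q)` of the central family, every constant history),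
the TEMPORAL BONDS `2 − Re tr(U_i(e)U_{i+1}(e)ᴴ)` are at their minimum, so their first variation vanishes in EVERY frame direction
(`temporal_insertion_re_trace_eq_zero`: `Re tr(UYUᴴ + U(UY′)ᴴ) = Re tr Y + Re tr Y′ᴴ = 0` for traceless `Y, Y′`).  Hence the frame gradient there is
the seam part plus the plaquette part of the insertion formula ✓`fderiv_ringPoly_apply` only:

  ★★ `frameD_ringPoly_constSlices` : `frameD Y ringPoly (ringCoord ((fun _ => U), V)) = −(Σ_seam … + Σ_plaquettes …)` (explicit insertions).

HONEST FRAMING: first step of the explicit vertex; the wrap-layer case analysis of the two remaining sums is NOT here; ⟨24141⟩ stays OPEN; the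
Yang–Mills mass gap is NOT proved; no summit is proved by a line.  THEOREMS ONLY (0 `def`, 0 `sorry`), standard axioms.  Width seat
`ym-line-sfw-p2-w3` g58 (cell ym-idea-1, free hands), `--supports stmt-QuantumFields-24141`.  References: [cite: arXiv220412737, §2 (2.4) (p. 10)].
-/

set_option autoImplicit false

noncomputable section

open scoped Matrix BigOperators ContDiff Topology
open Literature.MathematicalPhysics.QuantumFieldTheory hiding SU2
open Literature.MathematicalPhysics.QuantumLattice
open Literature.MathematicalPhysics.QuantumFieldTheory.SUNBakryEmery (matTop)

namespace Summit.QuantumFields.YangMills.Theorems.VirialFluxGap.FrameDerivative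

open Summit.QuantumFields.YangMills.Theorems.FemtoTransferGap
open Summit.QuantumFields.YangMills.Theorems.VirialFluxGap.FrameHessian

variable {L : ℕ} [NeZero L]

open scoped Matrix.Norms.Frobenius

attribute [local instance 2000] Literature.MathematicalPhysics.QuantumFieldTheory.SUNBakryEmery.matTop

/-! ## §1 The temporal insertion vanishes at equal slices -/

omit [NeZero L] in
/-- Conjugation by a special unitary matrix preserves `Re tr`: `Re tr(U A Uᴴ) = Re tr A`. [folklore] -/
theorem re_trace_conj_su2 (U : SU2) (A : Matrix (Fin 2) (Fin 2) ℂ) :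
    (((U : Matrix (Fin 2) (Fin 2) ℂ) * A * (U : Matrix (Fin 2) (Fin 2) ℂ)ᴴ).trace).re = (A.trace).re := by
  have hU : (U : Matrix (Fin 2) (Fin 2) ℂ)ᴴ * (U : Matrix (Fin 2) (Fin 2) ℂ) = 1 := by
    have h := (Matrix.mem_specialUnitaryGroup_iff.1 U.2).1
    rw [Matrix.mem_unitaryGroup_iff'] at h
    exact h
  rw [Matrix.trace_mul_cycle, hU, Matrix.one_mul]

omit [NeZero L] in
/-- ★ **The temporal-bond insertion vanishes at equal slices**: `Re tr(U Y Uᴴ + U (U Y′)ᴴ) = 0` for traceless `Y, Y′` and `U ∈ SU(2)`. [folklore] -/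
theorem temporal_insertion_re_trace_eq_zero (U : SU2) (Y Y' : Matrix (Fin 2) (Fin 2) ℂ) (hY0 : Y.trace = 0) (hY'0 : Y'.trace = 0) :
    (((U : Matrix (Fin 2) (Fin 2) ℂ) * Y * (U : Matrix (Fin 2) (Fin 2) ℂ)ᴴ +
        (U : Matrix (Fin 2) (Fin 2) ℂ) * ((U : Matrix (Fin 2) (Fin 2) ℂ) * Y')ᴴ).trace).re = 0 := by
  rw [Matrix.conjTranspose_mul, ← Matrix.mul_assoc, Matrix.trace_add, Complex.add_re, re_trace_conj_su2, re_trace_conj_su2, hY0,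
    Matrix.trace_conjTranspose, hY'0]
  simp

/-! ## §2 The frame gradient at a history with equal slices -/

/-- ★★ **First variation at equal slices = seam part + plaquette part.**  For a history `((fun _ => U), V)` with all slices equal and any
traceless direction assignment `Y`, the frame derivative of `ringPoly` is MINUS the seam insertions MINUS the plaquette insertions of
✓`fderiv_ringPoly_apply` (the temporal double sum vanishes termwise). [cite: arXiv220412737, §2 (2.4) (p. 10)] -/
theorem frameD_ringPoly_constSlices (U : GaugeConfig 3 L SU2) (V : Site 3 L → SU2)
    (Y : ((Fin (2 * L - 1 + 1) × Edge 3 L) ⊕ Site 3 L) → Matrix (Fin 2) (Fin 2) ℂ) (hY0 : ∀ w, (Y w).trace = 0) :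
    frameD Y (ringPoly L) (ringCoord L (((fun _ : Fin (2 * L - 1 + 1) => U), V) : (Fin (2 * L - 1 + 1) → GaugeConfig 3 L SU2) × (Site 3 L → SU2))) =
      -((∑ e : Edge 3 L,
          ((((U e : Matrix (Fin 2) (Fin 2) ℂ) * Y (Sum.inl (Fin.last (2 * L - 1), e))) *
                ((V e.1 : Matrix (Fin 2) (Fin 2) ℂ) * (U e : Matrix (Fin 2) (Fin 2) ℂ) * ((V (e.1.shift e.2) : Matrix (Fin 2) (Fin 2) ℂ))ᴴ)ᴴ +
              (U e : Matrix (Fin 2) (Fin 2) ℂ) *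
                (((V e.1 : Matrix (Fin 2) (Fin 2) ℂ) * Y (Sum.inr e.1)) * (U e : Matrix (Fin 2) (Fin 2) ℂ) * ((V (e.1.shift e.2) : Matrix (Fin 2) (Fin 2) ℂ))ᴴ +
                  (V e.1 : Matrix (Fin 2) (Fin 2) ℂ) * ((U e : Matrix (Fin 2) (Fin 2) ℂ) * Y (Sum.inl (0, e))) * ((V (e.1.shift e.2) : Matrix (Fin 2) (Fin 2) ℂ))ᴴ +
                  (V e.1 : Matrix (Fin 2) (Fin 2) ℂ) * (U e : Matrix (Fin 2) (Fin 2) ℂ) *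
                    (((V (e.1.shift e.2) : Matrix (Fin 2) (Fin 2) ℂ)) * Y (Sum.inr (e.1.shift e.2)))ᴴ)ᴴ).trace).re) +
        ∑ j : Fin (2 * L - 1 + 1), ∑ p : Plaquette 3 L,
          ((((U (p.1, p.2.1.1) : Matrix (Fin 2) (Fin 2) ℂ) * Y (Sum.inl (j, (p.1, p.2.1.1)))) * (U (p.1.shift p.2.1.1, p.2.1.2) : Matrix (Fin 2) (Fin 2) ℂ) *
                ((U (p.1.shift p.2.1.2, p.2.1.1) : Matrix (Fin 2) (Fin 2) ℂ))ᴴ * ((U (p.1, p.2.1.2) : Matrix (Fin 2) (Fin 2) ℂ))ᴴ +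
              (U (p.1, p.2.1.1) : Matrix (Fin 2) (Fin 2) ℂ) * ((U (p.1.shift p.2.1.1, p.2.1.2) : Matrix (Fin 2) (Fin 2) ℂ) * Y (Sum.inl (j, (p.1.shift p.2.1.1, p.2.1.2)))) *
                ((U (p.1.shift p.2.1.2, p.2.1.1) : Matrix (Fin 2) (Fin 2) ℂ))ᴴ * ((U (p.1, p.2.1.2) : Matrix (Fin 2) (Fin 2) ℂ))ᴴ +
              (U (p.1, p.2.1.1) : Matrix (Fin 2) (Fin 2) ℂ) * (U (p.1.shift p.2.1.1, p.2.1.2) : Matrix (Fin 2) (Fin 2) ℂ) *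
                (((U (p.1.shift p.2.1.2, p.2.1.1) : Matrix (Fin 2) (Fin 2) ℂ)) * Y (Sum.inl (j, (p.1.shift p.2.1.2, p.2.1.1))))ᴴ * ((U (p.1, p.2.1.2) : Matrix (Fin 2) (Fin 2) ℂ))ᴴ +
              (U (p.1, p.2.1.1) : Matrix (Fin 2) (Fin 2) ℂ) * (U (p.1.shift p.2.1.1, p.2.1.2) : Matrix (Fin 2) (Fin 2) ℂ) *
                ((U (p.1.shift p.2.1.2, p.2.1.1) : Matrix (Fin 2) (Fin 2) ℂ))ᴴ * (((U (p.1, p.2.1.2) : Matrix (Fin 2) (Fin 2) ℂ)) * Y (Sum.inl (j, (p.1, p.2.1.2))))ᴴ).trace).re) := by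
  rw [frameD, fderiv_ringPoly_apply]
  have htemp : (∑ i : Fin (2 * L - 1), ∑ e : Edge 3 L,
      (((mulTangent Y (ringCoord L (((fun _ : Fin (2 * L - 1 + 1) => U), V) :
          (Fin (2 * L - 1 + 1) → GaugeConfig 3 L SU2) × (Site 3 L → SU2)))).1 i.castSucc e *
          ((ringCoord L (((fun _ : Fin (2 * L - 1 + 1) => U), V) :
            (Fin (2 * L - 1 + 1) → GaugeConfig 3 L SU2) × (Site 3 L → SU2))).1 i.succ e)ᴴ +
        (ringCoord L (((fun _ : Fin (2 * L - 1 + 1) => U), V) :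
            (Fin (2 * L - 1 + 1) → GaugeConfig 3 L SU2) × (Site 3 L → SU2))).1 i.castSucc e *
          ((mulTangent Y (ringCoord L (((fun _ : Fin (2 * L - 1 + 1) => U), V) :
            (Fin (2 * L - 1 + 1) → GaugeConfig 3 L SU2) × (Site 3 L → SU2)))).1 i.succ e)ᴴ).trace).re) = 0 := by
    refine Finset.sum_eq_zero fun i _ => Finset.sum_eq_zero fun e _ => ?_
    exact temporal_insertion_re_trace_eq_zero (U e) _ _ (hY0 _) (hY0 _)
  rw [htemp, zero_add]
  rfl

end Summit.QuantumFields.YangMills.Theorems.VirialFluxGap.FrameDerivative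

end
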